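import Summits.CriticalPhenomena.PercolationContinuityZ3.Theorems.PercNearOneGluingNoHeavyLowerTailSahiC3CubeEvents

/-!
# `NoHeavyLowerTail` (crux stmt-CriticalPhenomena-4575), Sahi programme P1: Sahi's `C₃` holds on the cube `{0,1}⁴` for every
# product measure (COMPUTATIONAL: one `native_decide` evaluation of the cube check)

Support file (Sahi cell, seat `prim-sahi-p1`; `--supports stmt-CriticalPhenomena-4575`; COMPUTATIONAL).

**Theorem `sahiC3_cube_four`.**  For every `p : Fin 4 → [0,1]` and all increasing events `A, B, C ⊆ Set (Fin 4)`:
`0 ≤ E₃(A,B,C)` (`Literature.Probability.LatticeModels.sahiE3`, `μ = prodBernoulli p`).  Proof: `checkCube 4 16 = true`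
(`…SahiC3CubeCertCheck`: all `168` increasing bitmasks of the `4`-cube = the free distributive lattice on four generators,
`804 440` sorted triples, for each the `256` base-`2^16` digits of the three-copy Kronecker number are `≥ 2^15`, i.e. every
tensor-Bernstein coefficient of `E₃(A,B,C)` is a nonnegative integer), evaluated by compiled code (`native_decide`); then
`sahiE3_nonneg_of_checkCube`.  The same fibre sums were censused exhaustively and found nonnegative by two independent programs
(ttrl2 `rcomb_count.c`, k ≤ 5, 1.93·10¹¹ values; this seat's `py/comb.py`, m ≤ 4, 12.87 M values, 0 negative, min 0); the kernel
(`decide`) evaluation of `m ≤ 3` is `…SahiC3CubeLeThree`.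
-/

namespace Summit.CriticalPhenomena.PercolationContinuityZ3.Theorems.SahiC3Cube

open Literature.Probability.Percolation Literature.Probability.LatticeModels

/-- The cube check passes in dimension `4`: `168` increasing bitmasks, `804 440` sorted triples, base `2^16`
(compiled evaluation). [this work] -/
theorem checkCube_four : checkCube 4 16 = true := by native_decide

/-- **Sahi's `C₃` on `{0,1}⁴` for every product measure** (computational). [this work] -/
theorem sahiC3_cube_four (p : Fin 4 → unitInterval) {A B C : Set (Set (Fin 4))} (hA : IsUpperSet A) (hB : IsUpperSet B)
    (hC : IsUpperSet C) : 0 ≤ sahiE3 (prodBernoulli p) A B C :=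
  sahiE3_nonneg_of_checkCube checkCube_four p hA hB hC

end Summit.CriticalPhenomena.PercolationContinuityZ3.Theorems.SahiC3Cube
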